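import Summits.MatrixMultiplication.MatrixMultiplication.Theorems.SoloInformedKroneckerCatalyst
import Literature.Computability.AlgebraicComplexity.KoszulBorderRank

/-!
# Slice ranks of Kronecker products with `T_cw,2`: every non-zero slice of `u ⊠ T_cw,2^{⊠N}` has rank `≥ 2^N · r(u)`

Solo seat `solo-MatrixMultiplication-informed` (generation 38); first of three files that VOID the
Kronecker-catalytic door D11' (`matrixMultiplication_of_cwTensor_two_kroneckerCatalyst`,
`SoloInformedKroneckerCatalyst.lean`): its hypothesis `z ⊠ ⟨m·3^N⟩ ⊵ z ⊠ ⟨m⟩ ⊠ T_cw,2^{⊠N}` is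
never satisfied (`SoloInformedKroneckerCatalystVacuous.lean`).  The obstruction is the rank of the
SLICES `u(γ) = ∑_a γ_a u_{a,·,·}` of the first factor (the image of the first flattening):

* `slice u γ`, `MinSliceRank u k` ("every non-zero first-factor slice of `u` has rank `≥ k`");
  `MinSliceRank` is invariant under relabelling the three index sets (`MinSliceRank.of_reindex`).
* `rank_add_rank_le_rank_fromBlocks`: a block lower-triangular matrix `[[B, 0], [A, D]]` over a
  field has rank `≥ rank B + rank D` (non-singular minors of `B` and `D` assemble to one of the
  block matrix; Horn–Johnson 0.4.4(d) for the minor characterisation of rank).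
* `MinSliceRank.kronecker_unitTensor`: `u ⊠ ⟨M⟩` keeps the bound (its slices are block diagonal).
* `MinSliceRank.kronecker_cwTensor_two`: `u ⊠ T_cw,2` DOUBLES it: a slice of `u ⊠ T_cw,2` is the
  block matrix `[[0, B, C], [B, A, 0], [C, 0, A]]` in three slices `A, B, C` of `u`, one of them
  non-zero, and each of `[[A,0],[0,A]]`, `[[B,0],[A,B]]`, `[[C,0],[A,C]]` is a submatrix.
* `MinSliceRank.kronecker_kroneckerPow_cwTensor_two`: hence `u ⊠ T_cw,2^{⊠N}` has all non-zero
  slices of rank `≥ 2^N k` — for `u = ⟨1⟩` this is the statement that the `3^N × 3^N` symmetric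
  slices of `T_cw,2^{⊠N}` have rank `≥ 2^N` (Landsberg 2017, §5.2.1: bounded-rank subspaces of
  the slice space are the equations used here, in their simplest form).

Everything is over an arbitrary field.  HONEST FRAMING: elementary linear algebra; the content is
in the use made of it by the two sequel files.

[cite: Landsberg2017, Prop. 5.2.1.2]
[cite: HornJohnson2013, §0.4.4 (d)]
[cite: BurgisserClausenShokrollahi1997, (14.17)]
-/

set_option linter.dupNamespace false
set_option linter.unusedSectionVars false

noncomputable section

namespace Summit.MatrixMultiplication.MatrixMultiplication.Theorems

open Literature.Computability.AlgebraicComplexity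
open scoped BigOperators

namespace SliceRank

variable {K : Type*} [Field K]

/-! ## Slices and the minimal slice rank -/

section Slice

variable {ι κ μ : Type*} [Fintype ι]

/-- The first-factor **slice** `u(γ) = ∑_a γ_a · u_{a,·,·}` of a 3-tensor `u`, a `κ × μ` matrix
(the image of `γ` under the first flattening). [cite: BurgisserClausenShokrollahi1997, (14.17)] -/
def slice (u : ι → κ → μ → K) (γ : ι → K) : Matrix κ μ K :=
  Matrix.of fun b c => ∑ a, γ a * u a b c

/-- Entries of a slice. [folklore] -/
@[simp] theorem slice_apply (u : ι → κ → μ → K) (γ : ι → K) (b : κ) (c : μ) :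
    slice u γ b c = ∑ a, γ a * u a b c := rfl

/-- The slice at the zero functional vanishes. [folklore] -/
theorem slice_zero (u : ι → κ → μ → K) : slice u 0 = 0 := by
  ext b c; simp

variable [Fintype κ] [Fintype μ]

/-- **`MinSliceRank u k`**: every NON-ZERO functional `γ` gives a slice `u(γ)` of rank `≥ k`
(for `k ≥ 1` this contains `1`-conciseness: no non-zero `γ` has `u(γ) = 0`).
[cite: Landsberg2017, Prop. 5.2.1.2] -/
def MinSliceRank (u : ι → κ → μ → K) (k : ℕ) : Prop :=
  ∀ γ : ι → K, γ ≠ 0 → k ≤ (slice u γ).rank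

/-- `MinSliceRank` is monotone in the bound. [folklore] -/
theorem MinSliceRank.mono {u : ι → κ → μ → K} {k j : ℕ} (h : MinSliceRank u k) (hjk : j ≤ k) :
    MinSliceRank u j :=
  fun γ hγ => hjk.trans (h γ hγ)

end Slice

/-! ## Relabelling the index sets -/

section Reindex

variable {ι κ μ ι₂ κ₂ μ₂ : Type*} [Fintype ι] [Fintype κ] [Fintype μ] [Fintype ι₂] [Fintype κ₂]
  [Fintype μ₂]

/-- The slice of a relabelled tensor is a relabelled slice. [folklore] -/
theorem slice_reindex (u : ι → κ → μ → K) (ea : ι₂ ≃ ι) (eb : κ₂ ≃ κ) (ec : μ₂ ≃ μ)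
    {u₂ : ι₂ → κ₂ → μ₂ → K} (hu : ∀ a b c, u₂ a b c = u (ea a) (eb b) (ec c)) (γ₂ : ι₂ → K) :
    slice u₂ γ₂ = (slice u (γ₂ ∘ ea.symm)).submatrix eb ec := by
  ext b c
  simp only [slice_apply, Matrix.submatrix_apply, Function.comp_apply, hu]
  rw [← ea.sum_comp]
  simp

/-- **`MinSliceRank` is invariant under relabelling** the three index sets along bijections.
[folklore] -/
theorem MinSliceRank.of_reindex {u : ι → κ → μ → K} {k : ℕ} (h : MinSliceRank u k) (ea : ι₂ ≃ ι)
    (eb : κ₂ ≃ κ) (ec : μ₂ ≃ μ) {u₂ : ι₂ → κ₂ → μ₂ → K}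
    (hu : ∀ a b c, u₂ a b c = u (ea a) (eb b) (ec c)) : MinSliceRank u₂ k := by
  intro γ₂ hγ₂
  rw [slice_reindex u ea eb ec hu γ₂, Matrix.rank_submatrix]
  refine h _ fun h0 => hγ₂ ?_
  funext a
  have := congr_fun h0 (ea a)
  simpa using this

end Reindex

/-! ## Block lower-triangular matrices -/

section Blocks

variable {m₁ m₂ n₁ n₂ : Type*} [Fintype m₁] [Fintype m₂] [Fintype n₁] [Fintype n₂]

/-- **Rank of a block lower-triangular matrix**: `rank B + rank D ≤ rank [[B, 0], [A, D]]` over a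
field (a non-singular `rank B`-minor of `B` and a non-singular `rank D`-minor of `D` give a
non-singular block-triangular minor of size `rank B + rank D`).
[cite: HornJohnson2013, §0.4.4 (d)] -/
theorem rank_add_rank_le_rank_fromBlocks (B : Matrix m₁ n₁ K) (A : Matrix m₂ n₁ K)
    (D : Matrix m₂ n₂ K) : B.rank + D.rank ≤ (Matrix.fromBlocks B 0 A D).rank := by
  classical
  obtain ⟨r₁, c₁, h₁⟩ := Matrix.exists_isUnit_det_submatrix_of_rank B
  obtain ⟨r₂, c₂, h₂⟩ := Matrix.exists_isUnit_det_submatrix_of_rank D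
  set M := Matrix.fromBlocks B 0 A D with hM
  set r : Fin B.rank ⊕ Fin D.rank → m₁ ⊕ m₂ := Sum.map r₁ r₂ with hr
  set c : Fin B.rank ⊕ Fin D.rank → n₁ ⊕ n₂ := Sum.map c₁ c₂ with hc
  have hsub : M.submatrix r c =
      Matrix.fromBlocks (B.submatrix r₁ c₁) 0 (A.submatrix r₂ c₁) (D.submatrix r₂ c₂) := by
    ext (i | i) (j | j) <;> simp [hM, hr, hc]
  have hdet : IsUnit (M.submatrix r c).det := by
    rw [hsub, Matrix.det_fromBlocks_zero₁₂]
    exact h₁.mul h₂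
  calc B.rank + D.rank = Fintype.card (Fin B.rank ⊕ Fin D.rank) := by simp
    _ = (M.submatrix r c).rank :=
        (Matrix.rank_of_isUnit _ ((Matrix.isUnit_iff_isUnit_det _).2 hdet)).symm
    _ ≤ M.rank := Matrix.rank_submatrix_le _ _ _

/-- A non-zero matrix over a field has rank `≥ 1` (a non-zero entry is a non-singular `1 × 1`
minor). [cite: HornJohnson2013, §0.4.4 (d)] -/
theorem one_le_rank_of_ne_zero {m n : Type*} [Fintype m] [Fintype n] {M : Matrix m n K}
    (hM : M ≠ 0) : 1 ≤ M.rank := by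
  classical
  obtain ⟨i, j, hij⟩ : ∃ i j, M i j ≠ 0 := by
    by_contra h
    simp only [not_exists, not_not] at h
    exact hM (Matrix.ext fun i j => by simpa using h i j)
  have hU : IsUnit (M.submatrix (fun _ : Fin 1 => i) (fun _ : Fin 1 => j)).det := by
    rw [Matrix.det_unique]
    exact isUnit_iff_ne_zero.2 hij
  exact Matrix.le_rank_of_isUnit_det_submatrix M _ _ hU

end Blocks

/-! ## Slices of Kronecker products -/

section Kronecker

variable {ι κ μ ι₁ κ₁ μ₁ : Type*} [Fintype ι] [Fintype κ] [Fintype μ] [Fintype ι₁] [Fintype κ₁]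
  [Fintype μ₁]

/-- **Slices of a Kronecker product**: `(u ⊠ v)(γ)_{(b,j),(c,k)} = ∑_i u(γ_{·,i})_{b,c} · v_{i,j,k}`,
a block matrix whose blocks are combinations of slices of `u` with the entries of `v` as
coefficients. [cite: BurgisserClausenShokrollahi1997, (14.17)] -/
theorem slice_kronecker_apply (u : ι → κ → μ → K) (v : ι₁ → κ₁ → μ₁ → K) (γ : ι × ι₁ → K)
    (b : κ × κ₁) (c : μ × μ₁) :
    slice (kroneckerTensor u v) γ b c = ∑ i, slice u (fun a => γ (a, i)) b.1 c.1 * v i b.2 c.2 := by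
  simp only [slice_apply, kroneckerTensor_apply, Fintype.sum_prod_type]
  rw [Finset.sum_comm]
  refine Finset.sum_congr rfl fun i _ => ?_
  rw [Finset.sum_mul]
  refine Finset.sum_congr rfl fun a _ => ?_
  ring

/-- A non-zero functional on `ι × ι₁` has a non-zero component `γ_{·,i}`. [folklore] -/
theorem exists_component_ne_zero {γ : ι × ι₁ → K} (hγ : γ ≠ 0) :
    ∃ i : ι₁, (fun a => γ (a, i)) ≠ 0 := by
  by_contra h
  simp only [not_exists, not_not] at h
  exact hγ (funext fun p => by simpa using congr_fun (h p.2) p.1)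

/-- **Unit tensors preserve the minimal slice rank**: the slices of `u ⊠ ⟨M⟩` are block diagonal
with blocks `u(γ_{·,i})`, so a non-zero one contains a non-zero slice of `u` as a submatrix.
[cite: BurgisserClausenShokrollahi1997, (14.17)] -/
theorem MinSliceRank.kronecker_unitTensor {u : ι → κ → μ → K} {k : ℕ} (h : MinSliceRank u k)
    (M : ℕ) : MinSliceRank (kroneckerTensor u (unitTensor K M)) k := by
  classical
  intro γ hγ
  obtain ⟨i, hi⟩ := exists_component_ne_zero hγ
  have hsub : (slice (kroneckerTensor u (unitTensor K M)) γ).submatrix (fun b => (b, i))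
      (fun c => (c, i)) = slice u (fun a => γ (a, i)) := by
    ext b c
    simp only [Matrix.submatrix_apply, slice_kronecker_apply, unitTensor_apply]
    rw [Finset.sum_eq_single i (fun i' _ hi' => by simp [hi']) (by simp)]
    simp
  calc k ≤ (slice u (fun a => γ (a, i))).rank := h _ hi
    _ = ((slice (kroneckerTensor u (unitTensor K M)) γ).submatrix (fun b => (b, i))
          (fun c => (c, i))).rank := by rw [hsub]
    _ ≤ _ := Matrix.rank_submatrix_le _ _ _

/-- The three blocks of a slice of `u ⊠ T_cw,2`: with `S_i = u(γ_{·,i})`,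
`∑_i S_i(b,c) · (T_cw,2)_{i,j,k}` is `0` at `(j,k) = (0,0)`, `S_k` on the first block row, `S_j` on
the first block column and `S_0 · [j = k]` elsewhere — the block matrix `[[0,B,C],[B,A,0],[C,0,A]]`
with `A = S_0, B = S_1, C = S_2`. [cite: ConnerGesmundoLandsbergVentura2022, eq. (1)] -/
theorem sum_mul_cwTensor_two (S : Fin 3 → K) (j k : Fin 3) :
    ∑ i, S i * cwTensor K 2 i j k =
      if j = 0 then (if k = 0 then 0 else S k)
      else if k = 0 then S j else if j = k then S 0 else 0 := by
  fin_cases j <;> fin_cases k <;> simp [Fin.sum_univ_three, cwTensor_apply]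

/-- **`T_cw,2` doubles the minimal slice rank**: a slice of `u ⊠ T_cw,2` is
`[[0,B,C],[B,A,0],[C,0,A]]` in three slices `A, B, C` of `u` (not all zero when the functional is
non-zero), and the submatrices `[[A,0],[0,A]]`, `[[B,0],[A,B]]`, `[[C,0],[A,C]]` are block
lower-triangular of rank `≥ 2·rank` of their diagonal block.
[cite: Landsberg2017, Prop. 5.2.1.2] [cite: ConnerGesmundoLandsbergVentura2022, eq. (1)] -/
theorem MinSliceRank.kronecker_cwTensor_two {u : ι → κ → μ → K} {k : ℕ} (h : MinSliceRank u k) :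
    MinSliceRank (kroneckerTensor u (cwTensor K 2)) (2 * k) := by
  classical
  intro γ hγ
  set T := slice (kroneckerTensor u (cwTensor K 2)) γ with hT
  set S : Fin 3 → Matrix κ μ K := fun i => slice u (fun a => γ (a, i)) with hS
  have hentry : ∀ (b : κ) (j : Fin 3) (c : μ) (k' : Fin 3), T (b, j) (c, k') =
      if j = 0 then (if k' = 0 then 0 else S k' b c)
      else if k' = 0 then S j b c else if j = k' then S 0 b c else 0 := by
    intro b j c k'
    rw [hT, slice_kronecker_apply, ← sum_mul_cwTensor_two (fun i => S i b c) j k']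
  -- the three block lower-triangular submatrices
  have h0 : T.submatrix (Sum.elim (fun b => (b, 1)) (fun b => (b, 2)))
      (Sum.elim (fun c => (c, 1)) (fun c => (c, 2))) = Matrix.fromBlocks (S 0) 0 0 (S 0) := by
    ext (b | b) (c | c) <;> simp [hentry]
  have h1 : T.submatrix (Sum.elim (fun b => (b, 0)) (fun b => (b, 1)))
      (Sum.elim (fun c => (c, 1)) (fun c => (c, 0))) = Matrix.fromBlocks (S 1) 0 (S 0) (S 1) := by
    ext (b | b) (c | c) <;> simp [hentry]
  have h2 : T.submatrix (Sum.elim (fun b => (b, 0)) (fun b => (b, 2)))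
      (Sum.elim (fun c => (c, 2)) (fun c => (c, 0))) = Matrix.fromBlocks (S 2) 0 (S 0) (S 2) := by
    ext (b | b) (c | c) <;> simp [hentry]
  have hge : ∀ i : Fin 3, 2 * (S i).rank ≤ T.rank := by
    intro i
    fin_cases i
    · calc 2 * (S 0).rank = (S 0).rank + (S 0).rank := by ring
        _ ≤ (Matrix.fromBlocks (S 0) 0 (0 : Matrix κ μ K) (S 0)).rank :=
            rank_add_rank_le_rank_fromBlocks _ _ _
        _ ≤ T.rank := by rw [← h0]; exact Matrix.rank_submatrix_le _ _ _
    · calc 2 * (S 1).rank = (S 1).rank + (S 1).rank := by ring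
        _ ≤ (Matrix.fromBlocks (S 1) 0 (S 0) (S 1)).rank := rank_add_rank_le_rank_fromBlocks _ _ _
        _ ≤ T.rank := by rw [← h1]; exact Matrix.rank_submatrix_le _ _ _
    · calc 2 * (S 2).rank = (S 2).rank + (S 2).rank := by ring
        _ ≤ (Matrix.fromBlocks (S 2) 0 (S 0) (S 2)).rank := rank_add_rank_le_rank_fromBlocks _ _ _
        _ ≤ T.rank := by rw [← h2]; exact Matrix.rank_submatrix_le _ _ _
  obtain ⟨i, hi⟩ := exists_component_ne_zero hγ
  calc 2 * k ≤ 2 * (S i).rank := Nat.mul_le_mul_left 2 (h _ hi)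
    _ ≤ T.rank := hge i

/-- Splitting off the last Kronecker factor: `ι × (Fin (N+1) → σ) ≃ (ι × (Fin N → σ)) × σ`,
`(a, f) ↦ ((a, init f), f(last))`. [folklore] -/
def splitLast (ι σ : Type*) (N : ℕ) : ι × (Fin (N + 1) → σ) ≃ (ι × (Fin N → σ)) × σ where
  toFun p := ((p.1, Fin.init p.2), p.2 (Fin.last N))
  invFun q := (q.1.1, Fin.snoc q.1.2 q.2)
  left_inv p := by simp [Fin.snoc_init_self]
  right_inv q := by simp [Fin.init_snoc, Fin.snoc_last]

/-- **Kronecker powers of `T_cw,2` multiply the minimal slice rank by `2^N`**: every non-zero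
first-factor slice of `u ⊠ T_cw,2^{⊠N}` has rank `≥ 2^N k` if those of `u` have rank `≥ k`
(induction on `N`, splitting off the last factor).  For `u = ⟨1⟩`, `k = 1`: the slices of
`T_cw,2^{⊠N}` have rank `≥ 2^N`. [cite: Landsberg2017, Prop. 5.2.1.2] -/
theorem MinSliceRank.kronecker_kroneckerPow_cwTensor_two {u : ι → κ → μ → K} {k : ℕ}
    (h : MinSliceRank u k) (N : ℕ) :
    MinSliceRank (kroneckerTensor u (kroneckerPow (cwTensor K 2) N)) (2 ^ N * k) := by
  induction N with
  | zero =>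
    rw [pow_zero, one_mul]
    refine h.of_reindex (Equiv.prodUnique ι (Fin 0 → Fin 3)) (Equiv.prodUnique κ (Fin 0 → Fin 3))
      (Equiv.prodUnique μ (Fin 0 → Fin 3)) fun a b c => ?_
    simp [kroneckerTensor_apply, kroneckerPow_apply]
  | succ N ih =>
    have h2 := ih.kronecker_cwTensor_two
    rw [show 2 ^ (N + 1) * k = 2 * (2 ^ N * k) by ring]
    refine h2.of_reindex (splitLast ι (Fin 3) N) (splitLast κ (Fin 3) N) (splitLast μ (Fin 3) N)
      fun a b c => ?_
    simp only [kroneckerTensor_apply, kroneckerPow_apply, splitLast, Equiv.coe_fn_mk,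
      Fin.prod_univ_castSucc, Fin.init]
    ring

/-- Reassociating: `z ⊠ (v ⊠ w)` has the minimal slice rank of `(z ⊠ v) ⊠ w`. [folklore] -/
theorem MinSliceRank.assoc {ι' κ' μ' : Type*} [Fintype ι'] [Fintype κ'] [Fintype μ']
    {z : ι → κ → μ → K} {v : ι₁ → κ₁ → μ₁ → K} {w : ι' → κ' → μ' → K} {k : ℕ}
    (h : MinSliceRank (kroneckerTensor (kroneckerTensor z v) w) k) :
    MinSliceRank (kroneckerTensor z (kroneckerTensor v w)) k := by
  refine h.of_reindex (Equiv.prodAssoc ι ι₁ ι').symm (Equiv.prodAssoc κ κ₁ κ').symm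
    (Equiv.prodAssoc μ μ₁ μ').symm fun a b c => ?_
  simp only [kroneckerTensor_apply, Equiv.prodAssoc_symm_apply]
  ring

/-- **The target tensor of door D11'**: if every non-zero slice of `z` has rank `≥ k`, then every
non-zero slice of `z ⊠ (⟨m⟩ ⊠ T_cw,2^{⊠N})` has rank `≥ 2^N k`.
[cite: Landsberg2017, Prop. 5.2.1.2] -/
theorem MinSliceRank.catalyticTarget {z : ι → κ → μ → K} {k : ℕ} (h : MinSliceRank z k)
    (m N : ℕ) :
    MinSliceRank (kroneckerTensor z (kroneckerTensor (unitTensor K m)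
      (kroneckerPow (cwTensor K 2) N))) (2 ^ N * k) :=
  ((h.kronecker_unitTensor m).kronecker_kroneckerPow_cwTensor_two N).assoc

end Kronecker

end SliceRank

end Summit.MatrixMultiplication.MatrixMultiplication.Theorems

end
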